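import Literature.Topology.FourManifolds.SymplecticPairStabilizerAdmissible
import Mathlib.LinearAlgebra.Matrix.NonsingularInverse
import Mathlib.LinearAlgebra.Matrix.Transvection
import HarnessLib

/-!
# The integral stabiliser of a pair of coordinate Lagrangians, II: the two diagonal blocks and
# their unimodularity

Topic `Literature/Topology/FourManifolds`; theorems only, sequel to
`SymplecticPairStabilizerAdmissible.lean` (partition `t : ι → Bool`, `T₀ = {t = false}`,
`T₊ = {t = true}`, the admissible automorphisms `F` of `ℤ^{ι × Bool}`: isometries of `ν` with
`F Λ_A ⊆ Λ_A`, `F Λ_t ⊆ Λ_t`, i.e. the matrices `(A, AS; 0, A⁻ᵀ)` with `A` block upper triangular).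
The two diagonal blocks of `A` — the `T₀ × T₀` block `(F δ_{a_q})_{a_p}` (`p, q ∈ T₀`) and the
`T₊ × T₊` block — written as `Matrix.of fun p q => F (Pi.single (q.1, false) 1) (p.1, false)` over
the subtypes `{t = false}`, `{t = true}`:

* `blockT0_mul`, `blockTplus_mul` — both blocks are multiplicative on admissible automorphisms;
* `isUnit_det_blockT0`, `isUnit_det_blockTplus` — both blocks are unimodular (symplectic duality
  against the `b`-coordinates: `Dᵀ A = 1` with `D_{p i} = (F δ_{b_i})_{b_p}`), so that the
  elementary generation of `GL(T₀, ℤ)` and `GL(T₊, ℤ)`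
  (`Literature.LinearAlgebra.Matrix.intElementary_induction_left`) applies to them;
* the blocks of the generators: `blockT0_moveZ`, `blockTplus_moveZ` (transvections
  `1 + n E_{ij}`), `block_signFlip` (`diag(1,…,-1,…,1)`), `blockT0_eq_one_of_fix`.

## References

* H. Zieschang, E. Vogt, H.-D. Coldewey, *Surfaces and Planar Discontinuous Groups*, LNM 835
  (1980), §3.6. [ZieschangVogtColdewey1980]
* W. A. Adkins, S. H. Weintraub, *Algebra. An Approach via Module Theory*, GTM 136 (1992), Ch. 5
  Thm. 2.10 (elementary generation of `GLₙ` over a Euclidean domain). [AdkinsWeintraub1992]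
-/

noncomputable section

namespace Literature.Topology.FourManifolds

open Finset Matrix

variable {ι : Type*} [Fintype ι] [DecidableEq ι]

/-! ## The two diagonal blocks are multiplicative -/

/-- **The `T₀ × T₀` block is multiplicative**: if the columns `G δ_{a_q}`, `q ∈ T₀`, lie in
`V = Λ_A ∩ Λ_t` then `((FG) δ_{a_q})_{a_p} = ∑_{r ∈ T₀} (F δ_{a_r})_{a_p} (G δ_{a_q})_{a_r}`.
[folklore] -/
theorem blockT0_mul (t : ι → Bool) (F G : (ι × Bool → ℤ) ≃ₗ[ℤ] (ι × Bool → ℤ))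
    (hG : ∀ q, t q = false → (∀ i, G (Pi.single (q, false) 1) (i, true) = 0) ∧
      ∀ i, t i = true → G (Pi.single (q, false) 1) (i, false) = 0) :
    (Matrix.of fun p q : {i // t i = false} => (F * G) (Pi.single (q.1, false) 1) (p.1, false)) =
      (Matrix.of fun p q : {i // t i = false} => F (Pi.single (q.1, false) 1) (p.1, false)) *
        Matrix.of fun p q : {i // t i = false} => G (Pi.single (q.1, false) 1) (p.1, false) := by
  ext p q
  rw [Matrix.mul_apply]
  simp only [Matrix.of_apply, linearEquiv_mul_apply]
  rw [map_eq_sum_T0 t F (hG q.1 q.2).1 (hG q.1 q.2).2]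
  exact Finset.sum_congr rfl fun r _ => mul_comm _ _

/-- **The `T₊ × T₊` block is multiplicative**: if the columns `G δ_{a_q}` lie in `Λ_A` and the
columns `F δ_{a_r}`, `r ∈ T₀`, lie in `V`, then
`((FG) δ_{a_q})_{a_p} = ∑_{r ∈ T₊} (F δ_{a_r})_{a_p} (G δ_{a_q})_{a_r}` for `p, q ∈ T₊`. [folklore] -/
theorem blockTplus_mul (t : ι → Bool) (F G : (ι × Bool → ℤ) ≃ₗ[ℤ] (ι × Bool → ℤ))
    (hG : ∀ q i, G (Pi.single (q, false) 1) (i, true) = 0)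
    (hF : ∀ r, t r = false → ∀ i, t i = true → F (Pi.single (r, false) 1) (i, false) = 0) :
    (Matrix.of fun p q : {i // t i = true} => (F * G) (Pi.single (q.1, false) 1) (p.1, false)) =
      (Matrix.of fun p q : {i // t i = true} => F (Pi.single (q.1, false) 1) (p.1, false)) *
        Matrix.of fun p q : {i // t i = true} => G (Pi.single (q.1, false) 1) (p.1, false) := by
  ext p q
  rw [Matrix.mul_apply]
  simp only [Matrix.of_apply, linearEquiv_mul_apply]
  rw [map_eq_sum F (hG q.1), ← Finset.sum_subtype (Finset.univ.filter fun i => t i = true) (by simp)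
    (fun r => F (Pi.single (r, false) 1) (p.1, false) * G (Pi.single (q.1, false) 1) (r, false)),
    Finset.sum_filter]
  refine Finset.sum_congr rfl fun r _ => ?_
  cases h : t r
  · simp [hF r h p.1 p.2]
  · simp [mul_comm]

/-! ## Both blocks are unimodular -/

/-- **The `T₀ × T₀` block of an admissible automorphism is unimodular**: pairing the columns
`F δ_{a_j} ∈ V` against `F δ_{b_i}` gives `Dᵀ A₀₀ = 1` with `D_{p i} = (F δ_{b_i})_{b_p}`.
[folklore] -/
theorem isUnit_det_blockT0 (t : ι → Bool) (F : (ι × Bool → ℤ) ≃ₗ[ℤ] (ι × Bool → ℤ))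
    (hS : ∀ u v, symplForm (F u) (F v) = symplForm u v)
    (hcol : ∀ q, t q = false → (∀ i, F (Pi.single (q, false) 1) (i, true) = 0) ∧
      ∀ i, t i = true → F (Pi.single (q, false) 1) (i, false) = 0) :
    IsUnit (Matrix.of fun p q : {i // t i = false} => F (Pi.single (q.1, false) 1) (p.1, false)).det := by
  refine Matrix.isUnit_det_of_left_inverse
    (B := (Matrix.of fun p q : {i // t i = false} => F (Pi.single (q.1, true) 1) (p.1, true))ᵀ) ?_
  ext i j
  rw [Matrix.mul_apply, Matrix.one_apply]
  simp only [Matrix.transpose_apply, Matrix.of_apply]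
  have key := hS (Pi.single (j.1, false) 1) (Pi.single (i.1, true) 1)
  rw [symplForm_single_false_left, one_mul, symplForm_apply] at key
  have hδ : (Pi.single (i.1, true) (1 : ℤ) : ι × Bool → ℤ) (j.1, true) = if i = j then 1 else 0 := by
    rw [Pi.single_apply]
    by_cases hij : i = j
    · subst hij; simp
    · rw [if_neg hij, if_neg]
      intro h'
      exact hij (Subtype.ext (Prod.mk.inj h').1.symm)
  rw [← hδ, ← key, ← Finset.sum_subtype (Finset.univ.filter fun x => t x = false) (by simp)
    (fun x => F (Pi.single (i.1, true) 1) (x, true) * F (Pi.single (j.1, false) 1) (x, false)),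
    Finset.sum_filter]
  refine Finset.sum_congr rfl fun x _ => ?_
  rw [(hcol j.1 j.2).1 x, zero_mul, sub_zero]
  cases h : t x
  · simp [mul_comm]
  · simp [(hcol j.1 j.2).2 x h]

/-- **The `T₊ × T₊` block of an admissible automorphism is unimodular**: pairing the columns
`F δ_{a_j} ∈ Λ_A` (`j ∈ T₊`) against `F δ_{b_i} ∈ Λ_t` (`i ∈ T₊`). [folklore] -/
theorem isUnit_det_blockTplus (t : ι → Bool) (F : (ι × Bool → ℤ) ≃ₗ[ℤ] (ι × Bool → ℤ))
    (hS : ∀ u v, symplForm (F u) (F v) = symplForm u v)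
    (hcolA : ∀ q i, F (Pi.single (q, false) 1) (i, true) = 0)
    (hcolT : ∀ i, t i = true → ∀ p, t p = false → F (Pi.single (i, true) 1) (p, true) = 0) :
    IsUnit (Matrix.of fun p q : {i // t i = true} => F (Pi.single (q.1, false) 1) (p.1, false)).det := by
  refine Matrix.isUnit_det_of_left_inverse
    (B := (Matrix.of fun p q : {i // t i = true} => F (Pi.single (q.1, true) 1) (p.1, true))ᵀ) ?_
  ext i j
  rw [Matrix.mul_apply, Matrix.one_apply]
  simp only [Matrix.transpose_apply, Matrix.of_apply]
  have key := hS (Pi.single (j.1, false) 1) (Pi.single (i.1, true) 1)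
  rw [symplForm_single_false_left, one_mul, symplForm_apply] at key
  have hδ : (Pi.single (i.1, true) (1 : ℤ) : ι × Bool → ℤ) (j.1, true) = if i = j then 1 else 0 := by
    rw [Pi.single_apply]
    by_cases hij : i = j
    · subst hij; simp
    · rw [if_neg hij, if_neg]
      intro h'
      exact hij (Subtype.ext (Prod.mk.inj h').1.symm)
  rw [← hδ, ← key, ← Finset.sum_subtype (Finset.univ.filter fun x => t x = true) (by simp)
    (fun x => F (Pi.single (i.1, true) 1) (x, true) * F (Pi.single (j.1, false) 1) (x, false)),
    Finset.sum_filter]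
  refine Finset.sum_congr rfl fun x _ => ?_
  rw [hcolA j.1 x, zero_mul, sub_zero]
  cases h : t x
  · simp [hcolT i.1 i.2 x h]
  · simp [mul_comm]

/-! ## The blocks of the generators -/

omit [Fintype ι] in
/-- The `a_p`-coordinate of `moveZ i j n δ_{a_q}`: the transvection `1 + n E_{ij}`. [folklore] -/
theorem moveZ_single_false_apply_false {i j : ι} (h : i ≠ j) (n : ℤ) (p q : ι) :
    moveZ i j h n (Pi.single (q, false) 1) (p, false) =
      (if p = q then 1 else 0) + if p = i ∧ q = j then n else 0 := by
  by_cases hpi : p = i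
  · subst hpi
    rw [moveZ_apply_false, Pi.single_apply, Pi.single_apply]
    simp only [Prod.mk.injEq, and_true, true_and]
    rcases eq_or_ne q j with rfl | hqj
    · simp
    · rw [if_neg hqj, if_neg (fun e : j = q => hqj e.symm), mul_zero]
  · rw [moveZ_apply_of_ne h n _ (by simpa using hpi) (by simp), Pi.single_apply]
    simp only [Prod.mk.injEq, and_true, hpi, false_and, if_false, add_zero]

omit [Fintype ι] in
/-- The `T₀ × T₀` block of `moveZ i j n` (`i, j ∈ T₀`) is the transvection `1 + n E_{ij}`. [folklore] -/
theorem blockT0_moveZ (t : ι → Bool) (i j : {x // t x = false}) (h : i ≠ j) (n : ℤ) :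
    (Matrix.of fun p q : {x // t x = false} =>
      moveZ i.1 j.1 (fun e => h (Subtype.ext e)) n (Pi.single (q.1, false) 1) (p.1, false)) =
      Matrix.transvection i j n := by
  ext p q
  rw [Matrix.of_apply, moveZ_single_false_apply_false, Matrix.transvection, Matrix.add_apply,
    Matrix.one_apply, Matrix.single]
  simp only [Matrix.of_apply, Subtype.ext_iff]
  by_cases h1 : (p : ι) = q <;> by_cases h2 : (i : ι) = p ∧ (j : ι) = q <;>
    simp [h1, h2, eq_comm]

omit [Fintype ι] in
/-- The `T₊ × T₊` block of `moveZ i j n` (`i, j ∈ T₊`) is the transvection `1 + n E_{ij}`. [folklore] -/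
theorem blockTplus_moveZ (t : ι → Bool) (i j : {x // t x = true}) (h : i ≠ j) (n : ℤ) :
    (Matrix.of fun p q : {x // t x = true} =>
      moveZ i.1 j.1 (fun e => h (Subtype.ext e)) n (Pi.single (q.1, false) 1) (p.1, false)) =
      Matrix.transvection i j n := by
  ext p q
  rw [Matrix.of_apply, moveZ_single_false_apply_false, Matrix.transvection, Matrix.add_apply,
    Matrix.one_apply, Matrix.single]
  simp only [Matrix.of_apply, Subtype.ext_iff]
  by_cases h1 : (p : ι) = q <;> by_cases h2 : (i : ι) = p ∧ (j : ι) = q <;>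
    simp [h1, h2, eq_comm]

omit [Fintype ι] in
/-- The sign change of handle `k` on `δ_{a_q}`. [folklore] -/
theorem signFlip_single_false_apply_false (k : ι) (E : (ι × Bool → ℤ) ≃ₗ[ℤ] (ι × Bool → ℤ))
    (hE : ∀ v p, E v p = (if p.1 = k then -1 else 1) * v p) (p q : ι) :
    E (Pi.single (q, false) 1) (p, false) = if p = q then (if p = k then -1 else 1) else 0 := by
  rw [hE, Pi.single_apply]
  simp only [Prod.mk.injEq, and_true]
  by_cases hpq : p = q <;> simp [hpq]

omit [Fintype ι] in
/-- The block of the sign change of handle `k` (in `T₀` or in `T₊`) is `diag(1,…,-1,…,1)`.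
[folklore] -/
theorem block_signFlip {s : Bool} (t : ι → Bool) (k : {x // t x = s})
    (E : (ι × Bool → ℤ) ≃ₗ[ℤ] (ι × Bool → ℤ)) (hE : ∀ v p, E v p = (if p.1 = k.1 then -1 else 1) * v p) :
    (Matrix.of fun p q : {x // t x = s} => E (Pi.single (q.1, false) 1) (p.1, false)) =
      Matrix.diagonal (Function.update (1 : {x // t x = s} → ℤ) k (-1)) := by
  ext p q
  rw [Matrix.of_apply, signFlip_single_false_apply_false k.1 E hE, Matrix.diagonal_apply,
    Function.update_apply, Pi.one_apply]
  by_cases h1 : p = q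
  · subst h1
    rw [if_pos rfl, if_pos rfl]
    by_cases h2 : p = k
    · subst h2; simp
    · rw [if_neg (fun e => h2 (Subtype.ext e)), if_neg h2]
  · rw [if_neg (fun e => h1 (Subtype.ext e)), if_neg h1]

omit [Fintype ι] in
/-- An automorphism fixing the `δ_{a_q}`, `q ∈ T₀`, has `T₀ × T₀` block `1`. [folklore] -/
theorem blockT0_eq_one_of_fix (t : ι → Bool) (F : (ι × Bool → ℤ) ≃ₗ[ℤ] (ι × Bool → ℤ))
    (hF : ∀ q, t q = false → F (Pi.single (q, false) 1) = Pi.single (q, false) 1) :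
    (Matrix.of fun p q : {x // t x = false} => F (Pi.single (q.1, false) 1) (p.1, false)) = 1 := by
  ext p q
  rw [Matrix.of_apply, hF q.1 q.2, Matrix.one_apply, Pi.single_apply]
  simp only [Prod.mk.injEq, and_true]
  by_cases h : p = q
  · subst h; simp
  · rw [if_neg (fun e => h (Subtype.ext e)), if_neg h]

end Literature.Topology.FourManifolds

end
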